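import Summits.QuantumFields.YangMills.Theorems.FlatTubeReductionReweightedProfile
import Summits.QuantumFields.YangMills.Theorems.FlatTubeReductionReferenceMoments
import Summits.QuantumFields.YangMills.Theorems.FlatTubeReductionReferenceDensityDomination
import HarnessLib

/-!
# PROFILE INTERFACE, part 1: the MOMENT NUMBER `Ξ` of the exact diagonal dressing from two profile-number ratios — `∫_{S′}ρ₁Λ⁴ ≤ Ξ₀·∫ρ₁` with `Ξ₀ = Ξ₀(L, A)` whenever
# `∫Ω̃₄ ≤ A·θ` and `∫Ω̃₄·(√β‖v̂‖)^{3n} ≤ A·θ` (`Ω̃₄ = Ω·(1+β‖v̂‖²)⁴`, `θ = ∫_C Ω` the profile mass of the fibre core `C ⊆ {cap, ‖v̂‖ ≤ β^{-1/2}, |v_{e,c}| ≤ β^{-1/2}}`)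
# (route `FlatTubeReduction`, crux K1 `NearFlatRatioLaw` stmt-QuantumFields-24720; seat `ym-line-ftr-p1` g14; rate twin «ratepack-v3 / frozen fibres»; R2b1 RECORD rung — no summit
# statement is proved here)

WHY (memo `Cruxes/NearFlatRatioLaw/Lines/ratepack-v3-frozen-g12.md` §6.1 (F8b)(iv); this is the first of the three interface hypotheses of `…ExactDressing.exactDressing_fields`).
The chain: `∫_{S′}ρ₁(Ω)Λ⁴ ≤ ∫ρ₁(Ω̃₄)(N+1)⁴` (`integral_levelWeight_le_reweighted`) `≤ κ₄(Ω̃₄)·∫ρ₁(Ω̃₄)` (`reference_moment_le`, `k = 4`, `D = 1`) `≤ κ₄·K₁·C·(…Ω̃₄-numbers…)`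
(`reference_mass_on_fibreSet_le`, `R = univ`) and `∫ρ₁(Ω) ≥ K₁·c₁·fpZ·(ρ³/10)^n·θ²` (`reference_mass_ge_floor`) at `ρ = r₀ = t₀ = β^{-1/2}`: `K₁` and `fpZ` cancel,
`(√β)^{-3n}/(ρ³/10)^n = 10^n`, `c₁ ≥ c₁* = exp(−(|E|(2+2√2)² + 100N₃ + 729945N_P))`, and the number ratios close the books.
* `exp_neg_mul_add_one_pow_four_le` (`e^{-x}(x+1)⁴ ≤ 200`), `diag_ratio_chain` (abstract four-step ratio bookkeeping), `inv_sqrt_window` (`β ≥ 900`: `s = (√β)⁻¹ ∈ (0, 1/30]`, `βs² = 1`),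
  `floorConst_le` (`c₁* ≤ c₁(β)`), ★★★ `profile_moment_number`.
HONEST FRAMING: bookkeeping of landed bricks; femto rung R2b1 (RECORD label); not infinite volume, not a gap, not Clay.  No defs, no named facts, no `sorry`.
-/

set_option autoImplicit false

noncomputable section

open MeasureTheory Filter Topology Real Set
open scoped BigOperators
open Literature.MathematicalPhysics.QuantumFieldTheory
open Literature.MathematicalPhysics.QuantumLattice

namespace Summit.QuantumFields.YangMills.Theorems.FemtoTransferGap.RateTube

open Summit.QuantumFields.YangMills.Theorems.FemtoTransferGap
open Summit.QuantumFields.YangMills.Theorems.FemtoTransferGap.TwoLattice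
open Summit.QuantumFields.YangMills.Theorems.FemtoTransferGap.TwoLattice.ConstTube
open Summit.QuantumFields.YangMills.Theorems.FemtoTransferGap.TwoLattice.Avg
open Summit.QuantumFields.YangMills.Theorems.FemtoTransferGap.TwoLattice.Cov
open Summit.QuantumFields.YangMills.Theorems.FemtoTransferGap.TwoLattice.Stiff (LinkSpace)

/-! ## §1 Scalar lemmas -/

section Scalar

/-- `e^{-x}(x+1)⁴ ≤ 200` for `x ≥ 0` (`(x+1)⁴ ≤ 8(1 + x⁴)` and `x⁴/4! ≤ eˣ`). [folklore] -/
theorem exp_neg_mul_add_one_pow_four_le {x : ℝ} (hx : 0 ≤ x) : Real.exp (-x) * (x + 1) ^ 4 ≤ 200 := by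
  have h1 : (x + 1) ^ 4 ≤ 8 * (1 + x ^ 4) := by nlinarith [sq_nonneg (x - 1), sq_nonneg (x + 1), sq_nonneg (x ^ 2 - 1), sq_nonneg x]
  have h2 : x ^ 4 / (Nat.factorial 4 : ℝ) ≤ Real.exp x := Real.pow_div_factorial_le_exp x hx 4
  have h4 : (Nat.factorial 4 : ℝ) = 24 := by norm_num [Nat.factorial]
  rw [h4] at h2
  have h3 : (1 : ℝ) ≤ Real.exp x := Real.one_le_exp hx
  have hpos : 0 < Real.exp x := Real.exp_pos x
  rw [Real.exp_neg]
  rw [inv_mul_le_iff₀ hpos]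
  nlinarith

/-- Abstract ratio bookkeeping: `A ≤ B ≤ κZ′`, `Z′ ≤ K·(C₁·C₂)`, `K·F ≤ Z` (`κ, C₁C₂ ≥ 0`, `K, F > 0`) ⇒ `A ≤ (κ·(C₁C₂)/F)·Z`. [folklore] -/
theorem diag_ratio_chain {A B κ Z' K C₁ C₂ F Z : ℝ} (h1 : A ≤ B) (h2 : B ≤ κ * Z') (h3 : Z' ≤ K * (C₁ * C₂)) (h4 : K * F ≤ Z) (hκ : 0 ≤ κ) (hK : 0 < K) (hF : 0 < F)
    (hC : 0 ≤ C₁ * C₂) : A ≤ κ * (C₁ * C₂) / F * Z := by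
  have h5 : A ≤ κ * (K * (C₁ * C₂)) := (h1.trans h2).trans (mul_le_mul_of_nonneg_left h3 hκ)
  have h6 : κ * (K * (C₁ * C₂)) = κ * (C₁ * C₂) / F * (K * F) := by field_simp
  rw [h6] at h5
  exact h5.trans (mul_le_mul_of_nonneg_left h4 (by positivity))

/-- The window `β ≥ 900`: `s = (√β)⁻¹` satisfies `0 < s ≤ 1/30`, `s ≤ 1`, `β·s² = 1`, `0 < β`. [folklore] -/
theorem inv_sqrt_window {β : ℝ} (hβ : 900 ≤ β) :
    0 < (Real.sqrt β)⁻¹ ∧ (Real.sqrt β)⁻¹ ≤ 1 / 30 ∧ (Real.sqrt β)⁻¹ ≤ 1 ∧ β * (Real.sqrt β)⁻¹ ^ 2 = 1 ∧ 0 < β := by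
  have hβ0 : 0 < β := by linarith
  have hs30 : 30 ≤ Real.sqrt β := by
    rw [show (30 : ℝ) = Real.sqrt 900 by rw [show (900 : ℝ) = 30 ^ 2 by norm_num, Real.sqrt_sq (by norm_num)]]
    exact Real.sqrt_le_sqrt hβ
  have hs0 : 0 < Real.sqrt β := by linarith
  refine ⟨inv_pos.mpr hs0, ?_, ?_, ?_, hβ0⟩
  · rw [inv_le_comm₀ hs0 (by norm_num)]; simpa using hs30
  · exact inv_le_one_of_one_le₀ (by linarith)
  · rw [inv_pow, Real.sq_sqrt hβ0.le, mul_inv_cancel₀ hβ0.ne']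

variable {L : ℕ} [NeZero L]

/-- **The floor constant**: at `ρ = r₀ = t₀ = (√β)⁻¹`, `β ≥ 900`, the kernel-ratio floor `c₁(β)` of `…ReferenceMassBounds` is at least
`c₁* = exp(−(|E|(2+2√2)² + 100N₃ + 729945N_P))`. [folklore] -/
theorem floorConst_le {β : ℝ} (hβ : 900 ≤ β) :
    Real.exp (-((Fintype.card (Edge 3 L) : ℝ) * (2 + 2 * Real.sqrt 2) ^ 2 + 100 * (Fintype.card (Plaquette 3 L × Fin 3) : ℝ) + 729945 * (Fintype.card (Plaquette 3 L) : ℝ))) ≤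
      Real.exp (-(β * ((Fintype.card (Edge 3 L) : ℝ) * (2 * (Real.sqrt β)⁻¹ + 2 * Real.sqrt 2 * (Real.sqrt β)⁻¹) ^ 2)) -
        β / 2 * (((10 * Real.sqrt (Fintype.card (Plaquette 3 L × Fin 3)) * (Real.sqrt β)⁻¹) ^ 2 + stepActionErr (L := L) (Real.sqrt β)⁻¹ 0) +
          ((10 * Real.sqrt (Fintype.card (Plaquette 3 L × Fin 3)) * (Real.sqrt β)⁻¹) ^ 2 + stepActionErr (L := L) (Real.sqrt β)⁻¹ 0))) := by
  obtain ⟨hs0, -, hs1, hβs, hβ0⟩ := inv_sqrt_window hβ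
  set s : ℝ := (Real.sqrt β)⁻¹ with hs
  have hN3 : 0 ≤ (Fintype.card (Plaquette 3 L × Fin 3) : ℝ) := Nat.cast_nonneg _
  have hNP : 0 ≤ (Fintype.card (Plaquette 3 L) : ℝ) := Nat.cast_nonneg _
  have hNE : 0 ≤ (Fintype.card (Edge 3 L) : ℝ) := Nat.cast_nonneg _
  have hsq3 : Real.sqrt (Fintype.card (Plaquette 3 L × Fin 3) : ℝ) ^ 2 = (Fintype.card (Plaquette 3 L × Fin 3) : ℝ) := Real.sq_sqrt hN3
  refine Real.exp_le_exp.mpr ?_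
  -- `β·(NE·(2s+2√2 s)²) = NE(2+2√2)²·(βs²)`
  have e1 : β * ((Fintype.card (Edge 3 L) : ℝ) * (2 * s + 2 * Real.sqrt 2 * s) ^ 2) = (Fintype.card (Edge 3 L) : ℝ) * (2 + 2 * Real.sqrt 2) ^ 2 * (β * s ^ 2) := by ring
  -- `β/2·(2(10√N₃ s)² + 2E(s,0)) = 100N₃(βs²) + βE(s,0)`
  have e2 : β / 2 * (((10 * Real.sqrt (Fintype.card (Plaquette 3 L × Fin 3) : ℝ) * s) ^ 2 + stepActionErr (L := L) s 0) +
      ((10 * Real.sqrt (Fintype.card (Plaquette 3 L × Fin 3) : ℝ) * s) ^ 2 + stepActionErr (L := L) s 0)) =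
      100 * (Fintype.card (Plaquette 3 L × Fin 3) : ℝ) * (β * s ^ 2) + β * stepActionErr (L := L) s 0 := by
    rw [mul_pow, mul_pow, hsq3]; ring
  -- `βE(s,0) = N_P(29376 s + 700569 s²)·(βs²)… ≤ 729945 N_P`
  have e3 : β * stepActionErr (L := L) s 0 ≤ 729945 * (Fintype.card (Plaquette 3 L) : ℝ) := by
    unfold stepActionErr
    rw [Real.sqrt_zero, mul_zero, zero_add]
    have h3 : β * s ^ 3 = s * (β * s ^ 2) := by ring
    have h4 : β * s ^ 4 = s ^ 2 * (β * s ^ 2) := by ring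
    have hs3 : β * s ^ 3 ≤ 1 := by rw [h3, hβs, mul_one]; exact hs1
    have hs4 : β * s ^ 4 ≤ 1 := by rw [h4, hβs, mul_one]; nlinarith
    have : β * ((Fintype.card (Plaquette 3 L) : ℝ) * (29376 * s ^ 3 + 700569 * s ^ 4)) =
        (Fintype.card (Plaquette 3 L) : ℝ) * (29376 * (β * s ^ 3) + 700569 * (β * s ^ 4)) := by ring
    rw [this]
    nlinarith [mul_le_mul_of_nonneg_left hs3 hNP, mul_le_mul_of_nonneg_left hs4 hNP]
  rw [e1, e2, hβs]
  linarith

end Scalar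

/-! ## §2 ★★★ The moment number from profile-number ratios -/

variable {L : ℕ} [NeZero L]

set_option maxHeartbeats 3200000 in
/-- ★★★ **THE MOMENT NUMBER `Ξ` FROM PROFILE-NUMBER RATIOS.**  For every `A ≥ 0` there is `Ξ₀ = Ξ₀(L, A) ≥ 0` such that for `β ≥ 900`, every profile `Ω` (measurable,
`0 ≤ Ω ≤ CΩ`, support in the capped balanced set with `‖v̂‖ ≤ R`), every FP window `ε > 0`, every measurable fibre core `C ⊆ {cap, ‖v̂‖ ≤ (√β)⁻¹, |v_{e,c}| ≤ (√β)⁻¹}` with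
`θ = ∫_C Ω dπ > 0`, and the two number ratios `∫Ω̃₄ dπ ≤ A·θ`, `∫Ω̃₄·(√β‖v̂‖)^{3n} dπ ≤ A·θ` (`Ω̃₄ = Ω·(1+β‖v̂‖²)⁴`, `n = |Λ|−1`), one has for EVERY level `T`:
`∫_{S′(T)} ρ₁(Ω)·Λ⁴ dμP ≤ Ξ₀·∫ρ₁(Ω) dμP` (`Λ = 1 + βkin + β‖v̂‖² + β‖v̂′‖²`, `S′(T) = {βkin ≤ T} ∩ {β‖v̂‖² ≤ T} ∩ {β‖v̂′‖² ≤ T} ∩ supp`). [cite: Luscher1983, §3] -/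
theorem profile_moment_number {A : ℝ} (hA : 0 ≤ A) :
    ∃ Ξ₀ : ℝ, 0 ≤ Ξ₀ ∧ ∀ {β : ℝ}, 900 ≤ β → ∀ {Ω : LinkSpace L → ℝ}, Measurable Ω → ∀ {CΩ : ℝ}, (∀ x, |Ω x| ≤ CΩ) → (∀ x, 0 ≤ Ω x) → ∀ {R : ℝ},
      (∀ v : Edge 3 L → Fin 3 → ℝ, Ω (linkEmbed L v) ≠ 0 → v ∈ capBalancedSet L ∧ ‖linkEmbed L v‖ ≤ R) → ∀ {ε : ℝ}, 0 < ε →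
      ∀ {C : Set (Edge 3 L → Fin 3 → ℝ)}, MeasurableSet C →
      (∀ v ∈ C, v ∈ capBalancedSet L ∧ ‖linkEmbed L v‖ ≤ (Real.sqrt β)⁻¹ ∧ ∀ (e : Edge 3 L) (c : Fin 3), |v e c| ≤ (Real.sqrt β)⁻¹) →
      0 < ∫ v in C, Ω (linkEmbed L v) ∂orthoTransverse L →
      ∫ v, Ω (linkEmbed L v) * (1 + β * ‖linkEmbed L v‖ ^ 2) ^ 4 ∂orthoTransverse L ≤ A * ∫ v in C, Ω (linkEmbed L v) ∂orthoTransverse L →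
      ∫ v, Ω (linkEmbed L v) * (1 + β * ‖linkEmbed L v‖ ^ 2) ^ 4 * (Real.sqrt β * ‖linkEmbed L v‖) ^ (3 * Fintype.card {x : Site 3 L // ¬x = 0}) ∂orthoTransverse L ≤
        A * ∫ v in C, Ω (linkEmbed L v) ∂orthoTransverse L →
      ∀ T : ℝ,
      ∫ p in ({p : (Edge 3 L → Fin 3 → ℝ) × ((Edge 3 L → Fin 3 → ℝ) × (Site 3 L → SU2)) | β * kinDefect L (orthoTube L 1 p.1) (orthoTube L 1 p.2.1) p.2.2 ≤ T} ∩
          {p | β * ‖linkEmbed L p.1‖ ^ 2 ≤ T} ∩ {p | β * ‖linkEmbed L p.2.1‖ ^ 2 ≤ T} ∩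
          {p | Ω (linkEmbed L p.1) ≠ 0 ∧ Ω (linkEmbed L p.2.1) ≠ 0 ∧ fpWeight L ε p.2.2 ≠ 0}),
        fpTriple L β Ω (fpWeight L ε) 1 1 p * (1 + β * kinDefect L (orthoTube L 1 p.1) (orthoTube L 1 p.2.1) p.2.2 + β * ‖linkEmbed L p.1‖ ^ 2 + β * ‖linkEmbed L p.2.1‖ ^ 2) ^ 4
        ∂((orthoTransverse L).prod ((orthoTransverse L).prod (gaugeMeasure L))) ≤
      Ξ₀ * ∫ p, fpTriple L β Ω (fpWeight L ε) 1 1 p ∂((orthoTransverse L).prod ((orthoTransverse L).prod (gaugeMeasure L))) := by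
  -- the constants of `L` (literal forms; abbreviated later)
  have hP0 : 0 ≤ (π ^ 2 / 12) ^ Fintype.card {x : Site 3 L // ¬x = 0} * (3 * (L : ℝ)) ^ (3 * Fintype.card {x : Site 3 L // ¬x = 0}) * 3 ^ (3 * Fintype.card {x : Site 3 L // ¬x = 0}) := by
    positivity
  have hc50 : 0 ≤ (5 * Real.sqrt 2) ^ (3 * Fintype.card {x : Site 3 L // ¬x = 0}) + Real.sqrt 2 ^ (3 * Fintype.card {x : Site 3 L // ¬x = 0}) := by positivity
  have hcstar0 : 0 < Real.exp (-((Fintype.card (Edge 3 L) : ℝ) * (2 + 2 * Real.sqrt 2) ^ 2 + 100 * (Fintype.card (Plaquette 3 L × Fin 3) : ℝ) +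
      729945 * (Fintype.card (Plaquette 3 L) : ℝ))) := Real.exp_pos _
  refine ⟨(5 * Real.exp 1 * 2 ^ 4 * 4 ^ (3 * Fintype.card {x : Site 3 L // ¬x = 0}) * (Nat.factorial 4 : ℝ) * (3 * Fintype.card {x : Site 3 L // ¬x = 0}).factorial *
      ((π ^ 2 / 12) ^ Fintype.card {x : Site 3 L // ¬x = 0} * (3 * (L : ℝ)) ^ (3 * Fintype.card {x : Site 3 L // ¬x = 0}) * 3 ^ (3 * Fintype.card {x : Site 3 L // ¬x = 0})) *
      10 ^ Fintype.card {x : Site 3 L // ¬x = 0} *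
      ((1 + ((5 * Real.sqrt 2) ^ (3 * Fintype.card {x : Site 3 L // ¬x = 0}) + Real.sqrt 2 ^ (3 * Fintype.card {x : Site 3 L // ¬x = 0}))) * A ^ 2) /
      Real.exp (-((Fintype.card (Edge 3 L) : ℝ) * (2 + 2 * Real.sqrt 2) ^ 2 + 100 * (Fintype.card (Plaquette 3 L × Fin 3) : ℝ) + 729945 * (Fintype.card (Plaquette 3 L) : ℝ)))) *
    (5 * Real.exp 1 * 4 ^ (3 * Fintype.card {x : Site 3 L // ¬x = 0}) * (3 * Fintype.card {x : Site 3 L // ¬x = 0}).factorial *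
      ((π ^ 2 / 12) ^ Fintype.card {x : Site 3 L // ¬x = 0} * (3 * (L : ℝ)) ^ (3 * Fintype.card {x : Site 3 L // ¬x = 0}) * 3 ^ (3 * Fintype.card {x : Site 3 L // ¬x = 0})) *
      10 ^ Fintype.card {x : Site 3 L // ¬x = 0} *
      ((1 + ((5 * Real.sqrt 2) ^ (3 * Fintype.card {x : Site 3 L // ¬x = 0}) + Real.sqrt 2 ^ (3 * Fintype.card {x : Site 3 L // ¬x = 0}))) * A ^ 2) /
      Real.exp (-((Fintype.card (Edge 3 L) : ℝ) * (2 + 2 * Real.sqrt 2) ^ 2 + 100 * (Fintype.card (Plaquette 3 L × Fin 3) : ℝ) + 729945 * (Fintype.card (Plaquette 3 L) : ℝ)))),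
    by positivity, ?_⟩
  intro β hβ Ω hΩm CΩ hCΩ hΩ0 R hΩt ε hε C hC hCsub hθ hI hM T
  haveI := isFiniteMeasure_orthoTransverse L
  haveI : SecondCountableTopology SU2 := secondCountableTopology_su2
  obtain ⟨hs0, hs30, hs1, hβs, hβ0⟩ := inv_sqrt_window hβ
  have hle := measurable_linkEmbed L
  have hK1p : 0 < transferKernel su2Rep ((L : ℝ) ^ 3 * β) (1 : GaugeConfig 3 1 SU2) 1 := transferKernel_pos _ _ _ _
  have hfpZ : 0 < fpZ ε := fpZ_pos hε
  -- the re-weighted profile, as an opaque function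
  obtain ⟨Ω', hΩ'def⟩ : ∃ Ω' : LinkSpace L → ℝ, Ω' = fun x => Ω x * (1 + β * ‖x‖ ^ 2) ^ 4 := ⟨_, rfl⟩
  obtain ⟨hΩ'm, hΩ'0, hΩ'b, hΩ't⟩ : Measurable Ω' ∧ (∀ x, 0 ≤ Ω' x) ∧ (∀ x, |Ω' x| ≤ CΩ * (1 + β * R ^ 2) ^ 4) ∧
      (∀ v : Edge 3 L → Fin 3 → ℝ, Ω' (linkEmbed L v) ≠ 0 → v ∈ capBalancedSet L ∧ ‖linkEmbed L v‖ ≤ R) := by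
    rw [hΩ'def]; exact reweight_props (L := L) hβ0.le hΩm hCΩ hΩ0 hΩt 4
  have hΩΩ' : ∀ x, Ω x ≤ Ω' x := fun x => by
    rw [hΩ'def]; dsimp only
    have h1 : (1 : ℝ) ≤ (1 + β * ‖x‖ ^ 2) ^ 4 := one_le_pow₀ (by nlinarith [mul_nonneg hβ0.le (sq_nonneg ‖x‖)])
    nlinarith [hΩ0 x]
  have hI' : ∫ v, Ω' (linkEmbed L v) ∂orthoTransverse L ≤ A * ∫ v in C, Ω (linkEmbed L v) ∂orthoTransverse L := by simpa only [hΩ'def] using hI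
  have hM' : ∫ v, Ω' (linkEmbed L v) * (Real.sqrt β * ‖linkEmbed L v‖) ^ (3 * Fintype.card {x : Site 3 L // ¬x = 0}) ∂orthoTransverse L ≤
      A * ∫ v in C, Ω (linkEmbed L v) ∂orthoTransverse L := by simpa only [hΩ'def] using hM
  have hθθ' : ∫ v in C, Ω (linkEmbed L v) ∂orthoTransverse L ≤ ∫ v in C, Ω' (linkEmbed L v) ∂orthoTransverse L :=
    setIntegral_mono_on (integrable_of_measurable_abs_le (orthoTransverse L) (hΩm.comp hle) (fun v => hCΩ _)).integrableOn
      (integrable_of_measurable_abs_le (orthoTransverse L) (hΩ'm.comp hle) (fun v => hΩ'b _)).integrableOn hC fun v _ => hΩΩ' _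
  have hθ'pos : 0 < ∫ v in C, Ω' (linkEmbed L v) ∂orthoTransverse L := lt_of_lt_of_le hθ hθθ'
  have hI'0 : 0 ≤ ∫ v, Ω' (linkEmbed L v) ∂orthoTransverse L := integral_nonneg fun v => hΩ'0 _
  have hM'0 : 0 ≤ ∫ v, Ω' (linkEmbed L v) * (Real.sqrt β * ‖linkEmbed L v‖) ^ (3 * Fintype.card {x : Site 3 L // ¬x = 0}) ∂orthoTransverse L :=
    integral_nonneg fun v => mul_nonneg (hΩ'0 _) (by positivity)
  -- step 1: the level weight against `Ω` is a kinetic weight against `Ω̃`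
  have hNm := ((continuous_kinDefect_joint (L := L)).measurable.comp
    (((measurable_orthoTube_right (L := L) 1).comp measurable_fst).prodMk
      (((measurable_orthoTube_right (L := L) 1).comp (measurable_fst.comp measurable_snd)).prodMk (measurable_snd.comp measurable_snd)))).const_mul β
  have hN0 : ∀ p : (Edge 3 L → Fin 3 → ℝ) × ((Edge 3 L → Fin 3 → ℝ) × (Site 3 L → SU2)), 0 ≤ β * kinDefect L (orthoTube L 1 p.1) (orthoTube L 1 p.2.1) p.2.2 := fun p =>
    mul_nonneg hβ0.le (kinDefect_nonneg _ _ _)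
  have hint : Integrable (fun p : (Edge 3 L → Fin 3 → ℝ) × ((Edge 3 L → Fin 3 → ℝ) × (Site 3 L → SU2)) =>
      fpTriple L β Ω' (fpWeight L ε) 1 1 p * (β * kinDefect L (orthoTube L 1 p.1) (orthoTube L 1 p.2.1) p.2.2 + 1) ^ 4)
      ((orthoTransverse L).prod ((orthoTransverse L).prod (gaugeMeasure L))) := by
    have hCΩ' : 0 ≤ CΩ * (1 + β * R ^ 2) ^ 4 := (abs_nonneg _).trans (hΩ'b 0)
    refine integrable_of_measurable_abs_le _ ((measurable_fpTriple β hΩ'm (measurable_fpWeight L ε) 1 1).mul ((hNm.add measurable_const).pow_const 4))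
      (C := transferKernel su2Rep ((L : ℝ) ^ 3 * β) (1 : GaugeConfig 3 1 SU2) 1 * ((CΩ * (1 + β * R ^ 2) ^ 4) * (CΩ * (1 + β * R ^ 2) ^ 4)) * 200) fun p => ?_
    have hρ := fpTriple_one_one_div_le (L := L) hβ0.le hΩ'0 (fun g => (fpWeight_mem_Icc L ε g).1) p
    rw [div_le_iff₀ hK1p] at hρ
    have hF : Ω' (linkEmbed L p.1) * (fpWeight L ε p.2.2 * Ω' (linkEmbed L p.2.1)) ≤ (CΩ * (1 + β * R ^ 2) ^ 4) * (CΩ * (1 + β * R ^ 2) ^ 4) := by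
      have a1 := (le_abs_self _).trans (hΩ'b (linkEmbed L p.1))
      have a2 := (le_abs_self _).trans (hΩ'b (linkEmbed L p.2.1))
      have hw := fpWeight_mem_Icc L ε p.2.2
      calc _ ≤ (CΩ * (1 + β * R ^ 2) ^ 4) * (1 * (CΩ * (1 + β * R ^ 2) ^ 4)) :=
            mul_le_mul a1 (mul_le_mul hw.2 a2 (hΩ'0 _) zero_le_one) (mul_nonneg hw.1 (hΩ'0 _)) hCΩ'
        _ = _ := by ring
    have hρ0 : 0 ≤ fpTriple L β Ω' (fpWeight L ε) 1 1 p := by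
      unfold fpTriple; exact mul_nonneg (hΩ'0 _) (mul_nonneg (mul_nonneg (fpWeight_mem_Icc L ε _).1 (transferKernel_pos _ _ _ _).le) (hΩ'0 _))
    rw [abs_of_nonneg (mul_nonneg hρ0 (by positivity))]
    have h200 := exp_neg_mul_add_one_pow_four_le (hN0 p)
    calc fpTriple L β Ω' (fpWeight L ε) 1 1 p * (β * kinDefect L (orthoTube L 1 p.1) (orthoTube L 1 p.2.1) p.2.2 + 1) ^ 4
        ≤ (Ω' (linkEmbed L p.1) * (fpWeight L ε p.2.2 * Ω' (linkEmbed L p.2.1)) *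
            Real.exp (-(β * kinDefect L (orthoTube L 1 p.1) (orthoTube L 1 p.2.1) p.2.2)) * transferKernel su2Rep ((L : ℝ) ^ 3 * β) (1 : GaugeConfig 3 1 SU2) 1) *
            (β * kinDefect L (orthoTube L 1 p.1) (orthoTube L 1 p.2.1) p.2.2 + 1) ^ 4 := mul_le_mul_of_nonneg_right hρ (by positivity)
      _ = transferKernel su2Rep ((L : ℝ) ^ 3 * β) (1 : GaugeConfig 3 1 SU2) 1 * (Ω' (linkEmbed L p.1) * (fpWeight L ε p.2.2 * Ω' (linkEmbed L p.2.1))) *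
            (Real.exp (-(β * kinDefect L (orthoTube L 1 p.1) (orthoTube L 1 p.2.1) p.2.2)) * (β * kinDefect L (orthoTube L 1 p.1) (orthoTube L 1 p.2.1) p.2.2 + 1) ^ 4) := by ring
      _ ≤ transferKernel su2Rep ((L : ℝ) ^ 3 * β) (1 : GaugeConfig 3 1 SU2) 1 * ((CΩ * (1 + β * R ^ 2) ^ 4) * (CΩ * (1 + β * R ^ 2) ^ 4)) * 200 :=
            mul_le_mul (mul_le_mul_of_nonneg_left hF hK1p.le) h200 (by positivity) (by positivity)
  have h1 := integral_levelWeight_le_reweighted (L := L) hβ0.le hΩ0 ε 4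
    ({p : (Edge 3 L → Fin 3 → ℝ) × ((Edge 3 L → Fin 3 → ℝ) × (Site 3 L → SU2)) | β * kinDefect L (orthoTube L 1 p.1) (orthoTube L 1 p.2.1) p.2.2 ≤ T} ∩
          {p | β * ‖linkEmbed L p.1‖ ^ 2 ≤ T} ∩ {p | β * ‖linkEmbed L p.2.1‖ ^ 2 ≤ T} ∩
          {p | Ω (linkEmbed L p.1) ≠ 0 ∧ Ω (linkEmbed L p.2.1) ≠ 0 ∧ fpWeight L ε p.2.2 ≠ 0}) (by rw [← hΩ'def]; exact hint)
  rw [← hΩ'def] at h1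
  -- step 2: the kinetic moment against `Ω̃`
  have hMm : Measurable fun p : (Edge 3 L → Fin 3 → ℝ) × ((Edge 3 L → Fin 3 → ℝ) × (Site 3 L → SU2)) => (β * kinDefect L (orthoTube L 1 p.1) (orthoTube L 1 p.2.1) p.2.2 + 1) ^ 4 :=
    (hNm.add measurable_const).pow_const 4
  have h2 := reference_moment_le (L := L) hβ0 hΩ'm hΩ'b hΩ'0 hΩ't hC hs30 hCsub hθ'pos hε hs0 hs1 hMm (fun p => by positivity) zero_le_one (k := 4) (D := 1)
    (M := fun p => (β * kinDefect L (orthoTube L 1 p.1) (orthoTube L 1 p.2.1) p.2.2 + 1) ^ 4) (fun p => by rw [one_mul])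
  -- step 3: the total mass of `ρ₁(Ω̃)` from above
  have h3 := reference_mass_on_fibreSet_le (L := L) hβ0 hΩ'm hΩ'b hΩ'0 hΩ't ε (MeasurableSet.univ : MeasurableSet (Set.univ : Set (Edge 3 L → Fin 3 → ℝ)))
  have eU : {p : (Edge 3 L → Fin 3 → ℝ) × ((Edge 3 L → Fin 3 → ℝ) × (Site 3 L → SU2)) | p.1 ∈ (Set.univ : Set (Edge 3 L → Fin 3 → ℝ))} = Set.univ := by
    ext p; simp
  rw [eU, Measure.restrict_univ, Measure.restrict_univ] at h3
  -- step 4: the floor for `ρ₁(Ω)`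
  have h4 := reference_mass_ge_floor (L := L) hβ0 hΩm hCΩ hΩ0 hΩt hC hs30 hCsub ε hs0 hs1
  -- the scaled fibre moments are multiples of `M'`
  have eM5 : ∫ v, Ω' (linkEmbed L v) * (Real.sqrt β * (5 * (Real.sqrt 2 * ‖linkEmbed L v‖))) ^ (3 * Fintype.card {x : Site 3 L // ¬x = 0}) ∂orthoTransverse L =
      (5 * Real.sqrt 2) ^ (3 * Fintype.card {x : Site 3 L // ¬x = 0}) * ∫ v, Ω' (linkEmbed L v) * (Real.sqrt β * ‖linkEmbed L v‖) ^ (3 * Fintype.card {x : Site 3 L // ¬x = 0}) ∂orthoTransverse L := by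
    rw [← integral_const_mul]
    refine integral_congr_ae (ae_of_all _ fun v => ?_)
    dsimp only
    rw [show Real.sqrt β * (5 * (Real.sqrt 2 * ‖linkEmbed L v‖)) = (5 * Real.sqrt 2) * (Real.sqrt β * ‖linkEmbed L v‖) by ring, mul_pow]; ring
  have eM2 : ∫ v, Ω' (linkEmbed L v) * (Real.sqrt β * (Real.sqrt 2 * ‖linkEmbed L v‖)) ^ (3 * Fintype.card {x : Site 3 L // ¬x = 0}) ∂orthoTransverse L =
      Real.sqrt 2 ^ (3 * Fintype.card {x : Site 3 L // ¬x = 0}) * ∫ v, Ω' (linkEmbed L v) * (Real.sqrt β * ‖linkEmbed L v‖) ^ (3 * Fintype.card {x : Site 3 L // ¬x = 0}) ∂orthoTransverse L := by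
    rw [← integral_const_mul]
    refine integral_congr_ae (ae_of_all _ fun v => ?_)
    dsimp only
    rw [show Real.sqrt β * (Real.sqrt 2 * ‖linkEmbed L v‖) = Real.sqrt 2 * (Real.sqrt β * ‖linkEmbed L v‖) by ring, mul_pow]; ring
  rw [eM5, eM2] at h3
  -- abbreviations (AFTER the bricks, so every hypothesis is rewritten consistently)
  set n : ℕ := Fintype.card {x : Site 3 L // ¬x = 0} with hn
  set s : ℝ := (Real.sqrt β)⁻¹ with hs
  set c5 : ℝ := (5 * Real.sqrt 2) ^ (3 * n) + Real.sqrt 2 ^ (3 * n) with hc5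
  set cstar : ℝ := Real.exp (-((Fintype.card (Edge 3 L) : ℝ) * (2 + 2 * Real.sqrt 2) ^ 2 + 100 * (Fintype.card (Plaquette 3 L × Fin 3) : ℝ) +
    729945 * (Fintype.card (Plaquette 3 L) : ℝ))) with hcstar
  set c₁ : ℝ := Real.exp (-(β * ((Fintype.card (Edge 3 L) : ℝ) * (2 * s + 2 * Real.sqrt 2 * s) ^ 2)) -
        β / 2 * (((10 * Real.sqrt (Fintype.card (Plaquette 3 L × Fin 3)) * s) ^ 2 + stepActionErr (L := L) s 0) +
          ((10 * Real.sqrt (Fintype.card (Plaquette 3 L × Fin 3)) * s) ^ 2 + stepActionErr (L := L) s 0))) with hc₁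
  set I' : ℝ := ∫ v, Ω' (linkEmbed L v) ∂orthoTransverse L with hI'def
  set M' : ℝ := ∫ v, Ω' (linkEmbed L v) * (Real.sqrt β * ‖linkEmbed L v‖) ^ (3 * n) ∂orthoTransverse L with hM'def
  set θ : ℝ := ∫ v in C, Ω (linkEmbed L v) ∂orthoTransverse L with hθdef
  set θ' : ℝ := ∫ v in C, Ω' (linkEmbed L v) ∂orthoTransverse L with hθ'def
  set Z : ℝ := fpZ ε with hZ
  set K1 : ℝ := transferKernel su2Rep ((L : ℝ) ^ 3 * β) (1 : GaugeConfig 3 1 SU2) 1 with hK1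
  set Ξa : ℝ := 5 * Real.exp 1 * 2 ^ 4 * 4 ^ (3 * n) * (Nat.factorial 4 : ℝ) * (3 * n).factorial * ((π ^ 2 / 12) ^ n * (3 * (L : ℝ)) ^ (3 * n) * 3 ^ (3 * n)) * 10 ^ n * ((1 + c5) * A ^ 2) / cstar with hΞa
  set Ξb : ℝ := 5 * Real.exp 1 * 4 ^ (3 * n) * (3 * n).factorial * ((π ^ 2 / 12) ^ n * (3 * (L : ℝ)) ^ (3 * n) * 3 ^ (3 * n)) * 10 ^ n * ((1 + c5) * A ^ 2) / cstar with hΞb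
  have hΞa0 : 0 ≤ Ξa := by rw [hΞa]; positivity
  have hΞb0 : 0 ≤ Ξb := by rw [hΞb]; positivity
  have hc₁ge : cstar ≤ c₁ := floorConst_le (L := L) hβ
  have hc₁pos : 0 < c₁ := Real.exp_pos _
  have hF : 0 < c₁ * (Z * (s ^ 3 / 10) ^ n * θ ^ 2) := by positivity
  have hκ0 : 0 ≤ 5 * Real.exp 1 * 2 ^ 4 * 4 ^ (3 * n) * (Nat.factorial 4 : ℝ) * (3 * n).factorial * 1 * 1 * (Z * ((π ^ 2 / 12) ^ n * (3 * (L : ℝ)) ^ (3 * n) * 3 ^ (3 * n) * s ^ (3 * n)) * (I' ^ 2 + c5 * I' * M')) /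
      (c₁ * (Z * (s ^ 3 / 10) ^ n * θ' ^ 2)) := by positivity
  have hCC : 0 ≤ 5 * Real.exp 1 * 4 ^ (3 * n) * (3 * n).factorial * (Z * (π ^ 2 / 12) ^ n * (3 * (L : ℝ)) ^ (3 * n) * 3 ^ (3 * n) * s ^ (3 * n)) * (I' * I' + (5 * Real.sqrt 2) ^ (3 * n) * M' * I' + I' * (Real.sqrt 2 ^ (3 * n) * M')) := by
    positivity
  have hchain := diag_ratio_chain h1 h2 h3 h4 hκ0 hK1p hF hCC
  refine hchain.trans (mul_le_mul_of_nonneg_right ?_ (integral_nonneg fun p => ?_))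
  swap
  · unfold fpTriple; exact mul_nonneg (hΩ0 _) (mul_nonneg (mul_nonneg (fpWeight_mem_Icc L ε _).1 (transferKernel_pos _ _ _ _).le) (hΩ0 _))
  -- the number bookkeeping: `κ' ≤ Ξa`, `(C₁C₂)/F ≤ Ξb`
  have hpow : (s ^ 3 / 10) ^ n * 10 ^ n = s ^ (3 * n) := by
    rw [← mul_pow, div_mul_cancel₀ _ (by norm_num : (10 : ℝ) ≠ 0), ← pow_mul]
  have hθ2 : θ ^ 2 ≤ θ' ^ 2 := pow_le_pow_left₀ hθ.le hθθ' 2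
  have hQ'' : I' ^ 2 + c5 * I' * M' ≤ (1 + c5) * A ^ 2 * θ ^ 2 := by
    have h1' : I' ^ 2 ≤ (A * θ) ^ 2 := pow_le_pow_left₀ hI'0 hI' 2
    have h2' : I' * M' ≤ (A * θ) * (A * θ) := mul_le_mul hI' hM' hM'0 (by positivity)
    nlinarith [mul_le_mul_of_nonneg_left h2' hc50]
  have hQ' : I' * I' + (5 * Real.sqrt 2) ^ (3 * n) * M' * I' + I' * (Real.sqrt 2 ^ (3 * n) * M') ≤ (1 + c5) * A ^ 2 * θ ^ 2 := by
    have h1' : I' * I' ≤ (A * θ) * (A * θ) := mul_le_mul hI' hI' hI'0 (by positivity)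
    have h2' : M' * I' ≤ (A * θ) * (A * θ) := mul_le_mul hM' hI' hI'0 (by positivity)
    have h3' : I' * M' ≤ (A * θ) * (A * θ) := mul_le_mul hI' hM' hM'0 (by positivity)
    have hp5 : 0 ≤ (5 * Real.sqrt 2) ^ (3 * n) := by positivity
    have hp2 : 0 ≤ Real.sqrt 2 ^ (3 * n) := by positivity
    have e : c5 = (5 * Real.sqrt 2) ^ (3 * n) + Real.sqrt 2 ^ (3 * n) := hc5
    nlinarith [mul_le_mul_of_nonneg_left h2' hp5, mul_le_mul_of_nonneg_left h3' hp2]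
  have hκ' : 5 * Real.exp 1 * 2 ^ 4 * 4 ^ (3 * n) * (Nat.factorial 4 : ℝ) * (3 * n).factorial * 1 * 1 * (Z * ((π ^ 2 / 12) ^ n * (3 * (L : ℝ)) ^ (3 * n) * 3 ^ (3 * n) * s ^ (3 * n)) * (I' ^ 2 + c5 * I' * M')) /
      (c₁ * (Z * (s ^ 3 / 10) ^ n * θ' ^ 2)) ≤ Ξa := by
    rw [div_le_iff₀ (by positivity), hΞa]
    have hnum : Z * ((π ^ 2 / 12) ^ n * (3 * (L : ℝ)) ^ (3 * n) * 3 ^ (3 * n) * s ^ (3 * n)) * (I' ^ 2 + c5 * I' * M') ≤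
        Z * (((π ^ 2 / 12) ^ n * (3 * (L : ℝ)) ^ (3 * n) * 3 ^ (3 * n)) * ((s ^ 3 / 10) ^ n * 10 ^ n)) * ((1 + c5) * A ^ 2 * θ' ^ 2) := by
      rw [hpow]
      refine mul_le_mul_of_nonneg_left (hQ''.trans ?_) (by positivity)
      exact mul_le_mul_of_nonneg_left hθ2 (by positivity)
    have hK0 : 0 ≤ 5 * Real.exp 1 * 2 ^ 4 * 4 ^ (3 * n) * (Nat.factorial 4 : ℝ) * (3 * n).factorial * 1 * 1 := by positivity
    calc 5 * Real.exp 1 * 2 ^ 4 * 4 ^ (3 * n) * (Nat.factorial 4 : ℝ) * (3 * n).factorial * 1 * 1 * (Z * ((π ^ 2 / 12) ^ n * (3 * (L : ℝ)) ^ (3 * n) * 3 ^ (3 * n) * s ^ (3 * n)) * (I' ^ 2 + c5 * I' * M'))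
        ≤ 5 * Real.exp 1 * 2 ^ 4 * 4 ^ (3 * n) * (Nat.factorial 4 : ℝ) * (3 * n).factorial * 1 * 1 *
          (Z * (((π ^ 2 / 12) ^ n * (3 * (L : ℝ)) ^ (3 * n) * 3 ^ (3 * n)) * ((s ^ 3 / 10) ^ n * 10 ^ n)) * ((1 + c5) * A ^ 2 * θ' ^ 2)) :=
          mul_le_mul_of_nonneg_left hnum hK0
      _ = (5 * Real.exp 1 * 2 ^ 4 * 4 ^ (3 * n) * (Nat.factorial 4 : ℝ) * (3 * n).factorial * ((π ^ 2 / 12) ^ n * (3 * (L : ℝ)) ^ (3 * n) * 3 ^ (3 * n)) * 10 ^ n * ((1 + c5) * A ^ 2) / cstar) * (cstar * (Z * (s ^ 3 / 10) ^ n * θ' ^ 2)) := by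
          rw [div_mul_eq_mul_div, eq_div_iff hcstar0.ne']; ring
      _ ≤ (5 * Real.exp 1 * 2 ^ 4 * 4 ^ (3 * n) * (Nat.factorial 4 : ℝ) * (3 * n).factorial * ((π ^ 2 / 12) ^ n * (3 * (L : ℝ)) ^ (3 * n) * 3 ^ (3 * n)) * 10 ^ n * ((1 + c5) * A ^ 2) / cstar) * (c₁ * (Z * (s ^ 3 / 10) ^ n * θ' ^ 2)) := by
          refine mul_le_mul_of_nonneg_left (mul_le_mul_of_nonneg_right hc₁ge (by positivity)) ?_
          rw [← hΞa]; exact hΞa0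
  have hCF : 5 * Real.exp 1 * 4 ^ (3 * n) * (3 * n).factorial * (Z * (π ^ 2 / 12) ^ n * (3 * (L : ℝ)) ^ (3 * n) * 3 ^ (3 * n) * s ^ (3 * n)) * (I' * I' + (5 * Real.sqrt 2) ^ (3 * n) * M' * I' + I' * (Real.sqrt 2 ^ (3 * n) * M')) /
      (c₁ * (Z * (s ^ 3 / 10) ^ n * θ ^ 2)) ≤ Ξb := by
    rw [div_le_iff₀ hF, hΞb]
    have hnum : Z * (π ^ 2 / 12) ^ n * (3 * (L : ℝ)) ^ (3 * n) * 3 ^ (3 * n) * s ^ (3 * n) * (I' * I' + (5 * Real.sqrt 2) ^ (3 * n) * M' * I' + I' * (Real.sqrt 2 ^ (3 * n) * M')) ≤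
        Z * (((π ^ 2 / 12) ^ n * (3 * (L : ℝ)) ^ (3 * n) * 3 ^ (3 * n)) * ((s ^ 3 / 10) ^ n * 10 ^ n)) * ((1 + c5) * A ^ 2 * θ ^ 2) := by
      rw [hpow]
      calc Z * (π ^ 2 / 12) ^ n * (3 * (L : ℝ)) ^ (3 * n) * 3 ^ (3 * n) * s ^ (3 * n) * (I' * I' + (5 * Real.sqrt 2) ^ (3 * n) * M' * I' + I' * (Real.sqrt 2 ^ (3 * n) * M'))
          = Z * (((π ^ 2 / 12) ^ n * (3 * (L : ℝ)) ^ (3 * n) * 3 ^ (3 * n)) * s ^ (3 * n)) * (I' * I' + (5 * Real.sqrt 2) ^ (3 * n) * M' * I' + I' * (Real.sqrt 2 ^ (3 * n) * M')) := by ring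
        _ ≤ _ := mul_le_mul_of_nonneg_left hQ' (by positivity)
    have hK3 : 0 ≤ 5 * Real.exp 1 * 4 ^ (3 * n) * ((3 * n).factorial : ℝ) := by positivity
    calc 5 * Real.exp 1 * 4 ^ (3 * n) * (3 * n).factorial * (Z * (π ^ 2 / 12) ^ n * (3 * (L : ℝ)) ^ (3 * n) * 3 ^ (3 * n) * s ^ (3 * n)) * (I' * I' + (5 * Real.sqrt 2) ^ (3 * n) * M' * I' + I' * (Real.sqrt 2 ^ (3 * n) * M'))
        = 5 * Real.exp 1 * 4 ^ (3 * n) * (3 * n).factorial * ((Z * (π ^ 2 / 12) ^ n * (3 * (L : ℝ)) ^ (3 * n) * 3 ^ (3 * n) * s ^ (3 * n)) * (I' * I' + (5 * Real.sqrt 2) ^ (3 * n) * M' * I' + I' * (Real.sqrt 2 ^ (3 * n) * M'))) := by ring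
      _ ≤ 5 * Real.exp 1 * 4 ^ (3 * n) * (3 * n).factorial * (Z * (((π ^ 2 / 12) ^ n * (3 * (L : ℝ)) ^ (3 * n) * 3 ^ (3 * n)) * ((s ^ 3 / 10) ^ n * 10 ^ n)) * ((1 + c5) * A ^ 2 * θ ^ 2)) :=
          mul_le_mul_of_nonneg_left hnum hK3
      _ = (5 * Real.exp 1 * 4 ^ (3 * n) * (3 * n).factorial * ((π ^ 2 / 12) ^ n * (3 * (L : ℝ)) ^ (3 * n) * 3 ^ (3 * n)) * 10 ^ n * ((1 + c5) * A ^ 2) / cstar) * (cstar * (Z * (s ^ 3 / 10) ^ n * θ ^ 2)) := by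
          rw [div_mul_eq_mul_div, eq_div_iff hcstar0.ne']; ring
      _ ≤ (5 * Real.exp 1 * 4 ^ (3 * n) * (3 * n).factorial * ((π ^ 2 / 12) ^ n * (3 * (L : ℝ)) ^ (3 * n) * 3 ^ (3 * n)) * 10 ^ n * ((1 + c5) * A ^ 2) / cstar) * (c₁ * (Z * (s ^ 3 / 10) ^ n * θ ^ 2)) := by
          refine mul_le_mul_of_nonneg_left (mul_le_mul_of_nonneg_right hc₁ge (by positivity)) ?_
          rw [← hΞb]; exact hΞb0
  rw [mul_div_assoc]
  exact mul_le_mul hκ' hCF (div_nonneg hCC hF.le) hΞa0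

end Summit.QuantumFields.YangMills.Theorems.FemtoTransferGap.RateTube

end
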